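import Summits.QuantumFields.BalabanUV.Beta.D1BFx.PeriodicArrays
import Summits.QuantumFields.BalabanUV.Beta.D1BFx.ArrayTraceLimits
import Summits.QuantumFields.BalabanUV.Beta.D1BFx.MixedVarPackedHess

/-!
# `BalabanUV.Beta.D1BFx.TorusTraceTadpole` — road «BF-x» for binder row D1, slot (K), X₃(ii) ROUTE T, Tier A brick **TA3b**
# «TORUS TRACES → ℤ^D TRACES», the TORUS ↔ `ℤ^D` GLUE: the torus one-loop functionals of the periodised leg against the periodised
# ARRAYS of bi-localised vertices ARE `ℤ^D` diagonal image sums (exactly), hence converge to `tadpole` ∕ `bubble` ∕ `hessKer` with the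
# image-tail rates of brick TA3a

HONEST DEPENDENCY (cell records, verbatim): «continuum YM on T⁴ ⇐ BetaPertH ∧ nine spine estimates (0/9 proved); BetaPertH ⇐ (D1) ∧ (D4) ∧
CAP+tail; G-an2-4 gates asym, D1 and NE2/3/4.»  HONEST FRAMING (cell contract, verbatim): «discharging `BetaPertH` makes Bałaban's UV stability
UNCONDITIONAL — a real constructive-QFT result; it is NOT the continuum limit and NOT the Clay problem.»  THIS MODULE DISCHARGES NOTHING of (K),
of D1 or of the wall: [folklore] absolutely convergent lattice bookkeeping over an2's `ExpKernelCalculus` (`comp`, `tr`, `tadpole`, `bubble`,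
`hessKer`, `Decays`, `BiLoc`), an4's `EntrywiseVolumeLimit` (`periodise₂`, `imageShift`, `imageTail`), the D1 swarm's `FibredPeriodisation`
(`periodiseF`, `compF`, `periodiseF_compF_matrix`), brick TA2 `PeriodicArrays` (`arr`, `toF`, `comp_arr_right`, `comp_arr_arr`,
`sum_periodise₂_arr_diag`, …), brick TA3a `ArrayTraceLimits` (the two `ℤ^D` image-tail rates) and brick TA4 `MixedVarPackedHess` (`hessT`) — all
USED BY NAME.  No definition, no `def … : Prop`, nothing cited, 0 sorry.  NOT D1, NOT BetaPertH, NOT continuum, NOT Clay.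

ABSOLUTE RULE (cell charter, verbatim): «No internally-minted statement may enter as a cited fact. Every hypothesis is either kernel-proved in this
package or a verbatim quotation of a PUBLISHED theorem with page reference. The manuscript(s) under audit are NOT citable for their own disputed
steps — they are the thing under adjudication; programme-internal (2001/route/tribunal) claims are never citable.»

WHERE THIS SITS (`HOME/b2b-balaban-beta-d1-p2/K-ASSEMBLY-SPEC.md` v1 §1).  ROUTE T: the proved matrix identity `mixedVar_sliceTransfer_jets` on each
cubic torus `(ℤ∕s)^D` (TA4 reads its four `mixedVar`s as `2·hessT` of LEGS), then `s → ∞`.  The torus objects are PERIODISATIONS: the leg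
`Â := Matrix.of (periodiseF s (toF A))` of a decaying, jointly `s`-periodic `ℤ^D` kernel `A` (block covariance, `n ∣ s`), and the vertices
`(arr s V)^ := Matrix.of (periodiseF s (toF (arr s V)))` — periodisations of the PERIODIC ARRAYS of the bi-localised `ℤ^D` vertices (TA2: a single
excited bond on the torus lifts to the array, not to `periodise₂ V`).  THIS FILE: (B0) the `FKer` reading commutes with `comp`; (B1) by the fibred
product rule and TA2's `comp_arr_right` ∕ `comp_arr_arr`, `Â·(arr W)^ = (arr (A∘W))^` and `(Â(arr V)^)(Â(arr V′)^) = (arr ((A∘V) ∘ arr (A∘V′)))^`;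
(B2) by TA2's diagonal unfolding the torus traces are the `ℤ^D` sums `Σ_a Σ'_x Σ'_m K x (x + s·m) a a` with `K = A∘W` resp.
`K = (A∘V) ∘ arr s (A∘V′)` (bi-localised UNIFORMLY in `s`); (B3) TA3a's rates turn these into `|tr_T − tadpole A W|`, `|tr_T − bubble A V V′|`,
`|hessT − hessKer| ≤ const·imageTail D (c·s)` with `s`-free constants, and the `Tendsto` corollaries along any `σ → ∞` with `A` `σ k`-periodic.
Provenance: G-an2-4 formalisation swarm leaf seat `b2b-balaban-gan24-formalise-leaf-03` gen 43 (cross-lane, road «BF-x» brick K-TA3b; split of TA3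
with `gan24-formalise-leaf-06` = TA3a), 2026-08-20.
-/

noncomputable section

namespace Summit.QuantumFields.BalabanUV.Beta.D1BFx.TorusTraceTadpole

open Filter Topology
open scoped BigOperators
open Literature.MathematicalPhysics.QuantumFieldTheory.Balaban1983to89
open Literature.MathematicalPhysics.QuantumFieldTheory.Balaban1983to89.Beta
open B12Sec2to5 (l1 l1_nonneg summable_exp_neg_l1)
open ExpKernelCalculus (Site MKer Decays BiLoc comp tr bubble tadpole hessKer shiftK Zl Zl_pos Zl_nonneg summable_exp_shift summable_exp_shift'
  tsum_exp_shift tsum_exp_shift' biLoc_comp_decays)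
open KernelWard (Bdd bdd_of_decays)
open Summit.QuantumFields.BalabanUV.Beta.TameKernelCalculus (Spr Tame trK trK_comp decays_trK biLoc_trK decays_of_le biLoc_of_le)
open Summit.QuantumFields.BalabanUV.Beta.D1BFx.FibredPeriodisation (FKer Kfib compF periodiseF periodiseF_apply periodiseF_compF_matrix)
open Summit.QuantumFields.BalabanUV.Beta.D1BFx.PeriodicArrays (arr toF toF_apply Kfib_toF isPeriodic₂_arr rowBound_arr summable_abs_row_arr
  decays_arr bdd_arr sum_periodise₂_arr_diag comp_arr_right comp_arr_arr arr_imageShift)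
open Summit.QuantumFields.BalabanUV.Beta.D1BFx.MixedVarPackedHess (hessT)
open Summit.QuantumFields.BalabanUV.Beta.D1BFx.ArrayTraceLimits (abs_sum_diagImages_sub_tr_le abs_tr_comp_arr_sub_le)

variable {D : ℕ} {F : Type*} [Fintype F]

/-! ## §1 The `FKer` reading commutes with composition; rows of a decaying kernel -/

section ToF

variable {A B : MKer D F}

omit [Fintype F] in
/-- [folklore] A bi-localised kernel is bounded by its constant. -/
theorem bdd_of_biLoc {K : MKer D F} {p q : Site D} {C δ : ℝ} (hK : BiLoc K p q C δ) (hδ : 0 ≤ δ) : Bdd K C := by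
  intro x y a b
  refine (hK x y a b).trans ?_
  have h1 : Real.exp (-δ * (l1 (x - p) + l1 (y - q))) ≤ 1 := by
    rw [Real.exp_le_one_iff]; nlinarith [l1_nonneg (x - p), l1_nonneg (y - q)]
  exact (mul_le_mul_of_nonneg_left h1 (hK.nonneg a)).trans_eq (mul_one C)

omit [Fintype F] in
/-- [folklore] Fibrewise summability of the composition series: decaying left factor, bounded right factor. -/
theorem summable_mul_of_decays_bdd {CA δA CB : ℝ} (hA : Decays A CA δA) (hδA : 0 < δA) (hB : Bdd B CB) (x z : Site D) (a b f : F) :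
    Summable fun y : Site D => A x y a f * B y z f b := by
  refine Summable.of_norm_bounded ((summable_exp_shift hδA x).mul_left (CA * CB)) fun y => ?_
  rw [Real.norm_eq_abs, abs_mul]
  have hCA : 0 ≤ CA := hA.nonneg a
  calc |A x y a f| * |B y z f b| ≤ (CA * Real.exp (-δA * l1 (x - y))) * CB :=
        mul_le_mul (hA x y a f) (hB y z f b) (abs_nonneg _) (by positivity)
    _ = CA * CB * Real.exp (-δA * l1 (x - y)) := by ring

/-- [folklore] **THE `FKer` READING COMMUTES WITH COMPOSITION**: `compF (toF A) (toF B) = toF (comp A B)` (the fibre sum and the site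
series exchanged, fibrewise summability). -/
theorem toF_comp (h : ∀ x z a b f, Summable fun y : Site D => A x y a f * B y z f b) : compF (toF A) (toF B) = toF (comp A B) := by
  funext i j
  obtain ⟨x, a⟩ := i
  obtain ⟨z, b⟩ := j
  simp only [compF, toF_apply, comp]
  rw [Summable.tsum_finsetSum (fun f _ => h x z a b f)]

omit [Fintype F] in
/-- [folklore] The rows of every fibre of a decaying kernel are absolutely summable (the LEFT-factor hypothesis of
`FibredPeriodisation.periodiseF_compF_matrix`). -/
theorem summable_abs_row_toF {CA δA : ℝ} (hA : Decays A CA δA) (hδA : 0 < δA) (a b : F) (x : Site D) :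
    Summable fun y : Site D => |Kfib (toF A) a b x y| := by
  refine Summable.of_nonneg_of_le (fun _ => abs_nonneg _) (fun y => ?_) ((summable_exp_shift hδA x).mul_left CA)
  exact hA x y a b

end ToF

/-! ## §2 Torus products: the periodised leg against periodised arrays -/

section Products

variable {s : ℕ} [NeZero s] {A V V' W : MKer D F} {p q p' q' : Site D} {CA δA C Cv Cv' δ : ℝ}

/-- [folklore] **TADPOLE PRODUCT ON THE TORUS**: `Â · (arr s W)^ = (arr s (A ∘ W))^` — the periodised jointly-`s`-periodic decaying leg times the
periodised array of a bi-localised vertex is the periodised array of the `ℤ^D` product (fibred product rule + TA2's `comp_arr_right`). -/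
theorem periodiseF_toF_mul_arr (hA : Decays A CA δA) (hδA : 0 < δA)
    (hAper : ∀ x y t, ∀ a b : F, A (imageShift s x t) (imageShift s y t) a b = A x y a b) (hW : BiLoc W p q C δ) (hδ : 0 < δ) :
    Matrix.of (periodiseF s (toF A)) * Matrix.of (periodiseF s (toF (arr s W))) = Matrix.of (periodiseF s (toF (arr s (comp A W)))) := by
  rw [← comp_arr_right hA hδA hAper hW hδ,
    ← toF_comp (fun x z a b f => summable_mul_of_decays_bdd hA hδA (bdd_arr hW hδ s) x z a b f),
    periodiseF_compF_matrix (summable_abs_row_toF hA hδA) (isPeriodic₂_arr s W) (rowBound_arr hW hδ s)]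

/-- [folklore] **BUBBLE PRODUCT ON THE TORUS**: `(Â·(arr s V)^)·(Â·(arr s V′)^) = (arr s ((A ∘ V) ∘ arr s (A ∘ V′)))^` — the two dressed
arrays compose to the array of `X ∘ arr s Y`, `X := A ∘ V` bi-localised at `(p, p′)`, `Y := A ∘ V′` at `(q′, q)` (TA2's `comp_arr_arr`). -/
theorem periodiseF_toF_bubble (hA : Decays A CA δA) (hδA : 0 < δA)
    (hAper : ∀ x y t, ∀ a b : F, A (imageShift s x t) (imageShift s y t) a b = A x y a b)
    (hV : BiLoc V p p' Cv δ) (hV' : BiLoc V' q' q Cv' δ) (hδ : 0 < δ) :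
    Matrix.of (periodiseF s (toF A)) * Matrix.of (periodiseF s (toF (arr s V))) *
        (Matrix.of (periodiseF s (toF A)) * Matrix.of (periodiseF s (toF (arr s V')))) =
      Matrix.of (periodiseF s (toF (arr s (comp (comp A V) (arr s (comp A V')))))) := by
  -- common rate `δ₀ := min δA δ`, then `X := A ∘ V`, `Y := A ∘ V′` are bi-localised at rate `δ₀/2`
  set δ₀ : ℝ := min δA δ with hδ₀
  have hδ₀pos : 0 < δ₀ := lt_min hδA hδ
  have hA₀ : Decays A (|CA|) δ₀ := decays_of_le hA (min_le_left _ _)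
  have hV₀ : BiLoc V p p' (|Cv|) δ₀ := biLoc_of_le hV (min_le_right _ _)
  have hV'₀ : BiLoc V' q' q (|Cv'|) δ₀ := biLoc_of_le hV' (min_le_right _ _)
  have hX := biLoc_comp_decays hA₀ hV₀ (half_pos hδ₀pos).le (half_lt_self hδ₀pos)
  have hY := biLoc_comp_decays hA₀ hV'₀ (half_pos hδ₀pos).le (half_lt_self hδ₀pos)
  rw [periodiseF_toF_mul_arr hA hδA hAper hV hδ, periodiseF_toF_mul_arr hA hδA hAper hV' hδ,
    ← comp_arr_arr hX (half_pos hδ₀pos) hY (half_pos hδ₀pos),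
    ← toF_comp (fun x z a b f => summable_mul_of_decays_bdd (decays_arr hX (half_pos hδ₀pos) s) (half_pos (half_pos hδ₀pos))
      (bdd_arr hY (half_pos hδ₀pos) s) x z a b f),
    periodiseF_compF_matrix (summable_abs_row_arr hX (half_pos hδ₀pos) s) (isPeriodic₂_arr s _) (rowBound_arr hY (half_pos hδ₀pos) s)]

end Products

/-! ## §3 Exact unfoldings of the torus traces as `ℤ^D` diagonal image sums -/

section Traces

variable {s : ℕ} [NeZero s] {A V V' W K : MKer D F} {p q p' q' : Site D} {CA δA C Cv Cv' δ : ℝ}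

/-- [folklore] **THE TORUS TRACE OF A PERIODISED ARRAY IS THE DIAGONAL IMAGE SUM** `Σ_a Σ'_x Σ'_m K x (x + s·m) a a`
(TA2's `sum_periodise₂_arr_diag`, fibre by fibre). -/
theorem trace_periodiseF_toF_arr (hK : BiLoc K p q C δ) (hδ : 0 < δ) :
    Matrix.trace (Matrix.of (periodiseF s (toF (arr s K)))) = ∑ a, ∑' x : Site D, ∑' m : Site D, K x (imageShift s x m) a a := by
  simp only [Matrix.trace, Matrix.diag_apply, Matrix.of_apply, Fintype.sum_prod_type, periodiseF_apply]
  rw [Finset.sum_comm]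
  exact Finset.sum_congr rfl fun a _ => sum_periodise₂_arr_diag hK hδ a a

/-- [folklore] **TADPOLE UNFOLDING**: `tr_T(Â · (arr s W)^) = Σ_a Σ'_x Σ'_m (A ∘ W) x (x + s·m) a a`, `A ∘ W` bi-localised at `(p, q)` with the
`s`-FREE constant of `biLoc_comp_decays` at the common rate `min δA δ`. -/
theorem trace_tadpole_unfold (hA : Decays A CA δA) (hδA : 0 < δA)
    (hAper : ∀ x y t, ∀ a b : F, A (imageShift s x t) (imageShift s y t) a b = A x y a b) (hW : BiLoc W p q C δ) (hδ : 0 < δ) :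
    Matrix.trace (Matrix.of (periodiseF s (toF A)) * Matrix.of (periodiseF s (toF (arr s W)))) =
      ∑ a, ∑' x : Site D, ∑' m : Site D, comp A W x (imageShift s x m) a a := by
  have hδ₀pos : 0 < min δA δ := lt_min hδA hδ
  have hAW := biLoc_comp_decays (decays_of_le hA (min_le_left δA δ)) (biLoc_of_le hW (min_le_right δA δ)) (half_pos hδ₀pos).le
    (half_lt_self hδ₀pos)
  rw [periodiseF_toF_mul_arr hA hδA hAper hW hδ, trace_periodiseF_toF_arr hAW (half_pos hδ₀pos)]

/-- [folklore] **BUBBLE UNFOLDING**: `tr_T((Â·(arr V)^)·(Â·(arr V′)^)) = Σ_a Σ'_x Σ'_m ((A∘V) ∘ arr s (A∘V′)) x (x + s·m) a a`, the kernel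
`(A∘V) ∘ arr s (A∘V′)` being bi-localised at `(p, p′)` UNIFORMLY in `s` (TA2's `decays_arr`). -/
theorem trace_bubble_unfold (hA : Decays A CA δA) (hδA : 0 < δA)
    (hAper : ∀ x y t, ∀ a b : F, A (imageShift s x t) (imageShift s y t) a b = A x y a b)
    (hV : BiLoc V p p' Cv δ) (hV' : BiLoc V' q' q Cv' δ) (hδ : 0 < δ) :
    Matrix.trace (Matrix.of (periodiseF s (toF A)) * Matrix.of (periodiseF s (toF (arr s V))) *
        (Matrix.of (periodiseF s (toF A)) * Matrix.of (periodiseF s (toF (arr s V'))))) =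
      ∑ a, ∑' x : Site D, ∑' m : Site D, comp (comp A V) (arr s (comp A V')) x (imageShift s x m) a a := by
  set δ₀ : ℝ := min δA δ with hδ₀
  have hδ₀pos : 0 < δ₀ := lt_min hδA hδ
  have hA₀ : Decays A (|CA|) δ₀ := decays_of_le hA (min_le_left _ _)
  have hX := biLoc_comp_decays hA₀ (biLoc_of_le hV (min_le_right _ _) : BiLoc V p p' (|Cv|) δ₀) (half_pos hδ₀pos).le
    (half_lt_self hδ₀pos)
  have hY := biLoc_comp_decays hA₀ (biLoc_of_le hV' (min_le_right _ _) : BiLoc V' q' q (|Cv'|) δ₀) (half_pos hδ₀pos).le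
    (half_lt_self hδ₀pos)
  -- `X ∘ arr Y` is bi-localised at `(p, p′)`: transpose, `decays ∘ biLoc`, transpose back
  have hδ₄ : 0 < δ₀ / 2 / 2 := half_pos (half_pos hδ₀pos)
  have h1 := biLoc_comp_decays (decays_trK (decays_arr hY (half_pos hδ₀pos) s))
    (biLoc_of_le (biLoc_trK hX) (half_le_self (half_pos hδ₀pos).le)) (half_pos hδ₄).le (half_lt_self hδ₄)
  have hXY := biLoc_trK h1
  rw [← trK_comp, show trK (trK (comp (comp A V) (arr s (comp A V')))) = comp (comp A V) (arr s (comp A V')) from rfl] at hXY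
  rw [periodiseF_toF_bubble hA hδA hAper hV hV' hδ, trace_periodiseF_toF_arr hXY (half_pos hδ₄)]

end Traces


/-! ## §4 Assembly sockets: the torus functionals from `ℤ^D` image-tail bounds (TA3a supplies the bounds) -/

section Assembly

variable {s : ℕ} [NeZero s] {A V V' W : MKer D F} {p q p' q' : Site D} {CA δA C Cv Cv' δ : ℝ}

/-- [folklore] **TADPOLE SOCKET**: an image-tail bound for the diagonal image sum of `A ∘ W` IS a bound for `|tr_T(Â·(arr W)^) − tadpole A W|`. -/
theorem abs_trace_tadpole_sub_le_of (hA : Decays A CA δA) (hδA : 0 < δA)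
    (hAper : ∀ x y t, ∀ a b : F, A (imageShift s x t) (imageShift s y t) a b = A x y a b) (hW : BiLoc W p q C δ) (hδ : 0 < δ) {R : ℝ}
    (h : |(∑ a, ∑' x : Site D, ∑' m : Site D, comp A W x (imageShift s x m) a a) - tr (comp A W)| ≤ R) :
    |Matrix.trace (Matrix.of (periodiseF s (toF A)) * Matrix.of (periodiseF s (toF (arr s W)))) - tadpole A W| ≤ R := by
  rw [trace_tadpole_unfold hA hδA hAper hW hδ]
  exact h

/-- [folklore] **BUBBLE SOCKET**: the two `ℤ^D` bounds — the diagonal image tail of `X ∘ arr Y` and the array-versus-centre tail of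
`tr (X ∘ arr Y) − tr (X ∘ Y)`, `X = A∘V`, `Y = A∘V′` — add up to a bound for `|tr_T((Â(arr V)^)(Â(arr V′)^)) − bubble A V V′|`
(`bubble A V V′ = tr ((A∘V) ∘ (A∘V′))` by `rfl`). -/
theorem abs_trace_bubble_sub_le_of (hA : Decays A CA δA) (hδA : 0 < δA)
    (hAper : ∀ x y t, ∀ a b : F, A (imageShift s x t) (imageShift s y t) a b = A x y a b)
    (hV : BiLoc V p p' Cv δ) (hV' : BiLoc V' q' q Cv' δ) (hδ : 0 < δ) {R₁ R₂ : ℝ}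
    (h₁ : |(∑ a, ∑' x : Site D, ∑' m : Site D, comp (comp A V) (arr s (comp A V')) x (imageShift s x m) a a) -
        tr (comp (comp A V) (arr s (comp A V')))| ≤ R₁)
    (h₂ : |tr (comp (comp A V) (arr s (comp A V'))) - tr (comp (comp A V) (comp A V'))| ≤ R₂) :
    |Matrix.trace (Matrix.of (periodiseF s (toF A)) * Matrix.of (periodiseF s (toF (arr s V))) *
        (Matrix.of (periodiseF s (toF A)) * Matrix.of (periodiseF s (toF (arr s V'))))) - bubble A V V'| ≤ R₁ + R₂ := by
  rw [trace_bubble_unfold hA hδA hAper hV hV' hδ]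
  have e : bubble A V V' = tr (comp (comp A V) (comp A V')) := rfl
  rw [e]
  calc _ = |((∑ a, ∑' x : Site D, ∑' m : Site D, comp (comp A V) (arr s (comp A V')) x (imageShift s x m) a a) -
            tr (comp (comp A V) (arr s (comp A V')))) +
          (tr (comp (comp A V) (arr s (comp A V'))) - tr (comp (comp A V) (comp A V')))| := by ring_nf
    _ ≤ _ := (abs_add_le _ _).trans (add_le_add h₁ h₂)

/-- [folklore] **HESS SOCKET**: a tadpole bound `Rt` and a bubble bound `Rb` give
`|hessT Â (arr V)^ (arr V′)^ (arr W)^ − (½·tadpole A W − ½·bubble A V V′)| ≤ (Rt + Rb)/2`. -/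
theorem abs_hessT_sub_le_of {Rt Rb : ℝ}
    (ht : |Matrix.trace (Matrix.of (periodiseF s (toF A)) * Matrix.of (periodiseF s (toF (arr s W)))) - tadpole A W| ≤ Rt)
    (hb : |Matrix.trace (Matrix.of (periodiseF s (toF A)) * Matrix.of (periodiseF s (toF (arr s V))) *
        (Matrix.of (periodiseF s (toF A)) * Matrix.of (periodiseF s (toF (arr s V'))))) - bubble A V V'| ≤ Rb) :
    |hessT (Matrix.of (periodiseF s (toF A))) (Matrix.of (periodiseF s (toF (arr s V)))) (Matrix.of (periodiseF s (toF (arr s V'))))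
        (Matrix.of (periodiseF s (toF (arr s W)))) - ((1 / 2) * tadpole A W - (1 / 2) * bubble A V V')| ≤ (Rt + Rb) / 2 := by
  unfold hessT
  set T := Matrix.trace (Matrix.of (periodiseF s (toF A)) * Matrix.of (periodiseF s (toF (arr s W)))) with hT
  set B := Matrix.trace (Matrix.of (periodiseF s (toF A)) * Matrix.of (periodiseF s (toF (arr s V))) *
        (Matrix.of (periodiseF s (toF A)) * Matrix.of (periodiseF s (toF (arr s V'))))) with hB
  have e : (1 / 2 : ℝ) * (T - B) - ((1 / 2) * tadpole A W - (1 / 2) * bubble A V V') =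
      (1 / 2) * ((T - tadpole A W) - (B - bubble A V V')) := by ring
  rw [e, abs_mul, abs_of_pos (by norm_num : (0 : ℝ) < 1 / 2)]
  have := abs_sub (T - tadpole A W) (B - bubble A V V')
  linarith

/-- [folklore] **HESS SOCKET AT THE BASE-POINT FAMILIES**: with the first-order family `𝒱` and the second-order family `𝒲` of
`ExpKernelCalculus.hessKer`, `V := 𝒱 μ 0`, `V′ := 𝒱 ν z`, `W := 𝒲 μ 0 ν z`:
`|hessT Â (arr V)^ (arr V′)^ (arr W)^ − hessKer A 𝒱 𝒲 μ ν z| ≤ (Rt + Rb)/2`. -/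
theorem abs_hessT_sub_hessKer_le_of (𝒱 : Fin D → Site D → MKer D F) (𝒲 : Fin D → Site D → Fin D → Site D → MKer D F)
    (μ ν : Fin D) (z : Site D) {Rt Rb : ℝ}
    (ht : |Matrix.trace (Matrix.of (periodiseF s (toF A)) * Matrix.of (periodiseF s (toF (arr s (𝒲 μ 0 ν z))))) -
        tadpole A (𝒲 μ 0 ν z)| ≤ Rt)
    (hb : |Matrix.trace (Matrix.of (periodiseF s (toF A)) * Matrix.of (periodiseF s (toF (arr s (𝒱 μ 0)))) *
        (Matrix.of (periodiseF s (toF A)) * Matrix.of (periodiseF s (toF (arr s (𝒱 ν z)))))) - bubble A (𝒱 μ 0) (𝒱 ν z)| ≤ Rb) :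
    |hessT (Matrix.of (periodiseF s (toF A))) (Matrix.of (periodiseF s (toF (arr s (𝒱 μ 0)))))
        (Matrix.of (periodiseF s (toF (arr s (𝒱 ν z))))) (Matrix.of (periodiseF s (toF (arr s (𝒲 μ 0 ν z))))) -
      hessKer A 𝒱 𝒲 μ ν z| ≤ (Rt + Rb) / 2 :=
  abs_hessT_sub_le_of ht hb

end Assembly


/-! ## §5 Limit sockets: an image-tail rate along growing tori is a limit -/

section Limits

/-- [folklore] `M · imageTail D (c·σ k) → 0` along any `σ → ∞` (`c > 0`). -/
theorem tendsto_const_mul_imageTail {σ : ℕ → ℕ} (hσ : Tendsto σ atTop atTop) {c : ℝ} (hc : 0 < c) (M : ℝ) :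
    Tendsto (fun k => M * imageTail D (c * σ k)) atTop (𝓝 0) := by
  have h1 : Tendsto (fun k => c * (σ k : ℝ)) atTop atTop := Tendsto.const_mul_atTop hc (tendsto_natCast_atTop_atTop.comp hσ)
  simpa using ((tendsto_imageTail_atTop D).comp h1).const_mul M

/-- [folklore] **SQUEEZE SOCKET**: `|u k − L| ≤ M·imageTail D (c·σ k)` for all `k`, `c > 0`, `σ → ∞` ⟹ `u k → L`. -/
theorem tendsto_of_abs_sub_le_imageTail {u : ℕ → ℝ} {L M c : ℝ} {σ : ℕ → ℕ} (hσ : Tendsto σ atTop atTop) (hc : 0 < c)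
    (h : ∀ k, |u k - L| ≤ M * imageTail D (c * σ k)) : Tendsto u atTop (𝓝 L) := by
  have h0 := tendsto_const_mul_imageTail (D := D) hσ hc M
  rw [tendsto_iff_norm_sub_tendsto_zero]
  exact squeeze_zero (fun k => norm_nonneg _) (fun k => by rw [Real.norm_eq_abs]; exact h k) h0

/-- [folklore] Two-rate variant: `|u k − L| ≤ M₁·imageTail D (c₁·σ k) + M₂·imageTail D (c₂·σ k)` ⟹ `u k → L`. -/
theorem tendsto_of_abs_sub_le_imageTail₂ {u : ℕ → ℝ} {L M₁ M₂ c₁ c₂ : ℝ} {σ : ℕ → ℕ} (hσ : Tendsto σ atTop atTop) (hc₁ : 0 < c₁)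
    (hc₂ : 0 < c₂) (h : ∀ k, |u k - L| ≤ M₁ * imageTail D (c₁ * σ k) + M₂ * imageTail D (c₂ * σ k)) : Tendsto u atTop (𝓝 L) := by
  have h0 := (tendsto_const_mul_imageTail (D := D) hσ hc₁ M₁).add (tendsto_const_mul_imageTail (D := D) hσ hc₂ M₂)
  rw [add_zero] at h0
  rw [tendsto_iff_norm_sub_tendsto_zero]
  exact squeeze_zero (fun k => norm_nonneg _) (fun k => by rw [Real.norm_eq_abs]; exact h k) h0

end Limits


/-! ## §6 The rates and the limits: TA3a's image-tail bounds plugged into the unfoldings -/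

section Rates

variable {s : ℕ} [NeZero s] {A V V' W : MKer D F} {p q p' q' : Site D} {CA δA C Cv Cv' δ : ℝ}

/-- [folklore] **TADPOLE RATE**: `|tr_T(Â·(arr s W)^) − tadpole A W| ≤ C_tad · imageTail D ((min δA δ)∕4 · s)` with the `s`-FREE constant
`C_tad = |F|·(|F|·|CA|·|C|·Zl D (δ₀ − δ₀∕2))·Zl D (δ₀∕4)·e^{(δ₀∕4)|p−q|₁}`, `δ₀ = min δA δ` (TA3a (A1) at `K := A ∘ W`). -/
theorem abs_trace_tadpole_sub_tadpole_le (hA : Decays A CA δA) (hδA : 0 < δA)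
    (hAper : ∀ x y t, ∀ a b : F, A (imageShift s x t) (imageShift s y t) a b = A x y a b) (hW : BiLoc W p q C δ) (hδ : 0 < δ) :
    |Matrix.trace (Matrix.of (periodiseF s (toF A)) * Matrix.of (periodiseF s (toF (arr s W)))) - tadpole A W| ≤
      (Fintype.card F : ℝ) * ((Fintype.card F : ℝ) * (|CA| * |C|) * Zl D (min δA δ - min δA δ / 2)) * Zl D (min δA δ / 2 / 2) *
        Real.exp (min δA δ / 2 / 2 * l1 (p - q)) * imageTail D (min δA δ / 2 / 2 * s) := by
  have hδ₀pos : 0 < min δA δ := lt_min hδA hδ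
  have hAW := biLoc_comp_decays (decays_of_le hA (min_le_left δA δ)) (biLoc_of_le hW (min_le_right δA δ)) (half_pos hδ₀pos).le
    (half_lt_self hδ₀pos)
  exact abs_trace_tadpole_sub_le_of hA hδA hAper hW hδ (abs_sum_diagImages_sub_tr_le hAW (half_pos hδ₀pos))

/-- [folklore] **BUBBLE RATE**: `|tr_T((Â(arr V)^)(Â(arr V′)^)) − bubble A V V′| ≤ R₁(s) + R₂(s)`, `R₁` = TA3a (A1) at the `s`-uniformly bi-localised kernel
`(A∘V) ∘ arr s (A∘V′)` (rate `δ₀∕16`), `R₂` = TA3a (A2) at `(L, Y) := (A∘V, A∘V′)` (rate `δ₀∕4`), `δ₀ = min δA δ`; all constants `s`-free. -/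
theorem abs_trace_bubble_sub_bubble_le (hA : Decays A CA δA) (hδA : 0 < δA)
    (hAper : ∀ x y t, ∀ a b : F, A (imageShift s x t) (imageShift s y t) a b = A x y a b)
    (hV : BiLoc V p p' Cv δ) (hV' : BiLoc V' q' q Cv' δ) (hδ : 0 < δ) :
    |Matrix.trace (Matrix.of (periodiseF s (toF A)) * Matrix.of (periodiseF s (toF (arr s V))) *
        (Matrix.of (periodiseF s (toF A)) * Matrix.of (periodiseF s (toF (arr s V'))))) - bubble A V V'| ≤
      (Fintype.card F : ℝ) *
          ((Fintype.card F : ℝ) *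
              ((((Fintype.card F : ℝ) * (|CA| * |Cv'|) * Zl D (min δA δ - min δA δ / 2)) * Zl D (min δA δ / 2 / 2) *
                  Real.exp (min δA δ / 2 / 2 * l1 (q' - q))) *
                |(Fintype.card F : ℝ) * (|CA| * |Cv|) * Zl D (min δA δ - min δA δ / 2)|) *
            Zl D (min δA δ / 2 / 2 - min δA δ / 2 / 2 / 2)) *
          Zl D (min δA δ / 2 / 2 / 2 / 2) * Real.exp (min δA δ / 2 / 2 / 2 / 2 * l1 (p - p')) *
          imageTail D (min δA δ / 2 / 2 / 2 / 2 * s) +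
        (Fintype.card F : ℝ) ^ 2 *
          (((Fintype.card F : ℝ) * (|CA| * |Cv|) * Zl D (min δA δ - min δA δ / 2)) *
            ((Fintype.card F : ℝ) * (|CA| * |Cv'|) * Zl D (min δA δ - min δA δ / 2))) *
          Zl D (min δA δ / 2 / 2) ^ 2 * Real.exp (min δA δ / 2 / 2 * l1 (p' - q')) * imageTail D (min δA δ / 2 / 2 * s) := by
  have hδ₀pos : 0 < min δA δ := lt_min hδA hδ
  have hA₀ : Decays A (|CA|) (min δA δ) := decays_of_le hA (min_le_left _ _)
  have hX := biLoc_comp_decays hA₀ (biLoc_of_le hV (min_le_right _ _) : BiLoc V p p' (|Cv|) (min δA δ)) (half_pos hδ₀pos).le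
    (half_lt_self hδ₀pos)
  have hY := biLoc_comp_decays hA₀ (biLoc_of_le hV' (min_le_right _ _) : BiLoc V' q' q (|Cv'|) (min δA δ)) (half_pos hδ₀pos).le
    (half_lt_self hδ₀pos)
  have hδ₄ : 0 < min δA δ / 2 / 2 := half_pos (half_pos hδ₀pos)
  have h1 := biLoc_comp_decays (decays_trK (decays_arr hY (half_pos hδ₀pos) s))
    (biLoc_of_le (biLoc_trK hX) (half_le_self (half_pos hδ₀pos).le)) (half_pos hδ₄).le (half_lt_self hδ₄)
  have hXY := biLoc_trK h1
  rw [← trK_comp, show trK (trK (comp (comp A V) (arr s (comp A V')))) = comp (comp A V) (arr s (comp A V')) from rfl] at hXY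
  exact abs_trace_bubble_sub_le_of hA hδA hAper hV hV' hδ (abs_sum_diagImages_sub_tr_le hXY (half_pos hδ₄))
    (abs_tr_comp_arr_sub_le hX hY (half_pos hδ₀pos))

end Rates

/-! ## §7 The limits along growing tori -/

section TorusLimits

variable {A V V' W : MKer D F} {p q p' q' : Site D} {CA δA C Cv Cv' δ : ℝ} {σ : ℕ → ℕ} [∀ k, NeZero (σ k)]

/-- [folklore] **TADPOLE LIMIT**: along periods `σ_k → ∞` for which the leg is jointly `σ_k`-periodic (on the road: `σ_k = n·p_k`, `A` block-covariant
with block `n`), `tr_{T_{σ_k}}(Â·(arr W)^) → tadpole A W`. -/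
theorem tendsto_trace_tadpole (hA : Decays A CA δA) (hδA : 0 < δA)
    (hAper : ∀ k, ∀ x y t, ∀ a b : F, A (imageShift (σ k) x t) (imageShift (σ k) y t) a b = A x y a b)
    (hW : BiLoc W p q C δ) (hδ : 0 < δ) (hσ : Tendsto σ atTop atTop) :
    Tendsto (fun k => Matrix.trace (Matrix.of (periodiseF (σ k) (toF A)) * Matrix.of (periodiseF (σ k) (toF (arr (σ k) W)))))
      atTop (𝓝 (tadpole A W)) :=
  tendsto_of_abs_sub_le_imageTail (D := D) hσ (half_pos (half_pos (lt_min hδA hδ)))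
    (fun k => abs_trace_tadpole_sub_tadpole_le hA hδA (hAper k) hW hδ)

/-- [folklore] **BUBBLE LIMIT**: `tr_{T_{σ_k}}((Â(arr V)^)(Â(arr V′)^)) → bubble A V V′`. -/
theorem tendsto_trace_bubble (hA : Decays A CA δA) (hδA : 0 < δA)
    (hAper : ∀ k, ∀ x y t, ∀ a b : F, A (imageShift (σ k) x t) (imageShift (σ k) y t) a b = A x y a b)
    (hV : BiLoc V p p' Cv δ) (hV' : BiLoc V' q' q Cv' δ) (hδ : 0 < δ) (hσ : Tendsto σ atTop atTop) :
    Tendsto (fun k => Matrix.trace (Matrix.of (periodiseF (σ k) (toF A)) * Matrix.of (periodiseF (σ k) (toF (arr (σ k) V))) *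
        (Matrix.of (periodiseF (σ k) (toF A)) * Matrix.of (periodiseF (σ k) (toF (arr (σ k) V'))))))
      atTop (𝓝 (bubble A V V')) :=
  tendsto_of_abs_sub_le_imageTail₂ (D := D) hσ (half_pos (half_pos (half_pos (half_pos (lt_min hδA hδ)))))
    (half_pos (half_pos (lt_min hδA hδ))) (fun k => abs_trace_bubble_sub_bubble_le hA hδA (hAper k) hV hV' hδ)

/-- [folklore] **HESS LIMIT — THE POINT OF TA3**: for the base-point families `𝒱`, `𝒲` of `ExpKernelCalculus.hessKer` (first jets `𝒱 μ 0`, `𝒱 ν z` and mixed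
second jet `𝒲 μ 0 ν z`, all bi-localised at the common rate `δ`), the TORUS one-loop functional of the periodised leg against the periodised arrays
converges to the `ℤ^D` resolvent Hessian kernel: `hessT Â (arr (𝒱 μ 0))^ (arr (𝒱 ν z))^ (arr (𝒲 μ 0 ν z))^ → hessKer A 𝒱 𝒲 μ ν z`. -/
theorem tendsto_hessT_hessKer (hA : Decays A CA δA) (hδA : 0 < δA)
    (hAper : ∀ k, ∀ x y t, ∀ a b : F, A (imageShift (σ k) x t) (imageShift (σ k) y t) a b = A x y a b)
    (𝒱 : Fin D → Site D → MKer D F) (𝒲 : Fin D → Site D → Fin D → Site D → MKer D F) (μ ν : Fin D) (z : Site D)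
    (hV : BiLoc (𝒱 μ 0) p p' Cv δ) (hV' : BiLoc (𝒱 ν z) q' q Cv' δ) (hW : BiLoc (𝒲 μ 0 ν z) p q C δ) (hδ : 0 < δ)
    (hσ : Tendsto σ atTop atTop) :
    Tendsto (fun k => hessT (Matrix.of (periodiseF (σ k) (toF A))) (Matrix.of (periodiseF (σ k) (toF (arr (σ k) (𝒱 μ 0)))))
        (Matrix.of (periodiseF (σ k) (toF (arr (σ k) (𝒱 ν z))))) (Matrix.of (periodiseF (σ k) (toF (arr (σ k) (𝒲 μ 0 ν z))))))
      atTop (𝓝 (hessKer A 𝒱 𝒲 μ ν z)) := by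
  have ht := tendsto_trace_tadpole hA hδA hAper hW hδ hσ
  have hb := tendsto_trace_bubble hA hδA hAper hV hV' hδ hσ
  have h := (ht.sub hb).const_mul (1 / 2 : ℝ)
  have e : hessKer A 𝒱 𝒲 μ ν z = (1 / 2 : ℝ) * (tadpole A (𝒲 μ 0 ν z) - bubble A (𝒱 μ 0) (𝒱 ν z)) := by
    simp only [hessKer]; ring
  rw [e]
  exact h.congr fun k => rfl

end TorusLimits

end Summit.QuantumFields.BalabanUV.Beta.D1BFx.TorusTraceTadpole

end
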